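import Mathlib
import Summits.KontsevichZagierPeriods.Zeta5Search.ClassTypeGuards
import HarnessLib

/-!
# ζ(5) search — STAIRCASE cells, cover kit: window wrappers for an arbitrary parameter vector (DENOM-LAW D1, prover-d1)

HONEST FRAMING: systematic search; no irrationality claim unless certified.  Cell `pub-zeta5`, track «DENOM-LAW» D1.
The three window wrappers of `RecordRayLevels` (`record_LB / record_J / record_B`), restated for an ARBITRARY `b` (the per-ray files
of the staircase cells supply the ray facts): from a class-type cover of the residues (`ClassTypeCover.Cover`) and the decidable
checks, the bound `c ≤ v_p(Cas₇(b))` by THEOREM LB (`casoratianClassBound_holds`) / the Lemma-D bonus / the double-drop bonus, with the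
`checkLBx` fallback at the lattice points where the minimal exponent is not attained.  Valuations of rationals; nothing about
irrationality.
-/

open Finset

namespace Summit.KontsevichZagierPeriods.Zeta5Search.StairCoverKit

open Summit.KontsevichZagierPeriods.Zeta5Search.ClusterValuation
open Summit.KontsevichZagierPeriods.Zeta5Search.CasoratianValuation (InPolytope shift casoratian)
open Summit.KontsevichZagierPeriods.Zeta5Search.WedgeDictionary (dOf)
open Summit.KontsevichZagierPeriods.Zeta5Search.ClassTypeCover

variable {b : ℕ → ℤ} {p : ℕ}

/-- THEOREM LB for `Cas₇(b)` in the window. -/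
theorem cas_LB (hb : InPolytope b) (hb' : InPolytope (shift b 7)) (hpr : p.Prime) (hp5 : 5 ≤ p)
    (hwin : (b 0 + 2 : ℤ) < (p : ℤ) ^ 2) (hne : casoratian b 7 ≠ 0) : casLB b p ≤ padicValRat p (casoratian b 7) :=
  casoratianClassBound_holds b 7 p hb (by norm_num) (by norm_num) hb' hpr hp5 hwin hne

/-- **WINDOW BOUND by THEOREM LB**: `c ≤ v_p(Cas₇(b))` from a cover and `checkLB` at `A + B ≥ c` (`c ≤ 0`, `B ≤ 1`, `p ≤ d`). -/
theorem cover_LB (hb : InPolytope b) (hb' : InPolytope (shift b 7)) (hpr : p.Prime) (hp5 : 5 ≤ p)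
    (hpd : (p : ℤ) ≤ dOf b) (hwin : (b 0 + 2 : ℤ) < (p : ℤ) ^ 2)
    {TY : List (List ℤ × Bool)} (hcov : Cover b p TY) {A B c : ℤ}
    (hLB : checkLB (decide (¬ (2 : ℤ) ∣ b 0)) TY A B = true) (hB1 : B ≤ 1) (hc : c ≤ A + B) (hc0 : c ≤ 0)
    (hne : casoratian b 7 ≠ 0) : c ≤ padicValRat p (casoratian b 7) := by
  haveI : Fact p.Prime := ⟨hpr⟩
  have hv := cas_LB hb hb' hpr hp5 hwin hne
  rcases casLB_ge_of_cover hcov hLB hB1 hpd with h0 | h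
  · rw [h0] at hv; exact le_trans (by exact_mod_cast hc0) hv
  · linarith

/-- **WINDOW BOUND by the LEMMA-D BONUS**: `c ≤ v_p(Cas₇(b))` from a cover, `checkLB` at `(m, B)` with `c ≤ m + B + 1`,
`checkJ` at `m`, and the fallback `checkLBx` at `(m; A', B')` with `c ≤ A' + B'` where no multipole class attains `m`. -/
theorem cover_J (hb : InPolytope b) (hb' : InPolytope (shift b 7)) (hpr : p.Prime) (hp5 : 5 ≤ p)
    (hpb : (p : ℤ) ≤ b 0) (hpd : (p : ℤ) ≤ dOf b) (hwin : (b 0 + 2 : ℤ) < (p : ℤ) ^ 2)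
    {TY : List (List ℤ × Bool)} (hcov : Cover b p TY) {m B A' B' c : ℤ}
    (hLB : checkLB (decide (¬ (2 : ℤ) ∣ b 0)) TY m B = true) (hB1 : B ≤ 1)
    (hJ : checkJ (decide (¬ (2 : ℤ) ∣ b 0)) TY m = true)
    (hLBx : checkLBx (decide (¬ (2 : ℤ) ∣ b 0)) TY m A' B' = true) (hB1' : B' ≤ 1)
    (hc : c ≤ m + B + 1) (hc' : c ≤ A' + B') (hc0 : c ≤ 0)
    (hne : casoratian b 7 ≠ 0) : c ≤ padicValRat p (casoratian b 7) := by
  haveI : Fact p.Prime := ⟨hpr⟩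
  have hv := cas_LB hb hb' hpr hp5 hwin hne
  by_cases hreal : ∃ x, x < p ∧ 2 ≤ classPoleCount b p x ∧ classExp b p x = m
  · have hJ' := lemmaD_of_cover hb (by norm_num) (by norm_num) hb' hpr hp5 hpb hpd hwin hcov hJ hreal hne
    rcases casLB_ge_of_cover hcov hLB hB1 hpd with h0 | h
    · rw [h0] at hv; exact le_trans (by exact_mod_cast hc0) hv
    · linarith
  · rcases casLB_ge_of_cover_x hcov hLBx hB1' hpd hreal with h0 | h
    · rw [h0] at hv; exact le_trans (by exact_mod_cast hc0) hv
    · linarith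

/-- **WINDOW BOUND by the DOUBLE-DROP BONUS**: `c ≤ v_p(Cas₇(b))` from a cover, `checkLB` at `(−N, B)` with `c ≤ −N + B + 2`,
`checkB` at `N` (`N ≥ 3` even), and the fallback `checkLBx` at `(−N; A', B')` with `c ≤ A' + B'`. -/
theorem cover_B (hb : InPolytope b) (hb' : InPolytope (shift b 7)) (hpr : p.Prime) (hp5 : 5 ≤ p)
    (hpb : (p : ℤ) ≤ b 0) (hpd : (p : ℤ) ≤ dOf b) (hwin : (b 0 + 2 : ℤ) < (p : ℤ) ^ 2)
    {TY : List (List ℤ × Bool)} (hcov : Cover b p TY) {N : ℕ} (hN : 3 ≤ N) (hNe : Even N) {B A' B' c : ℤ}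
    (hLB : checkLB (decide (¬ (2 : ℤ) ∣ b 0)) TY (-(N : ℤ)) B = true) (hB1 : B ≤ 1)
    (hchkB : checkB (decide (¬ (2 : ℤ) ∣ b 0)) TY N = true)
    (hLBx : checkLBx (decide (¬ (2 : ℤ) ∣ b 0)) TY (-(N : ℤ)) A' B' = true) (hB1' : B' ≤ 1)
    (hc : c ≤ -(N : ℤ) + B + 2) (hc' : c ≤ A' + B') (hc0 : c ≤ 0)
    (hne : casoratian b 7 ≠ 0) : c ≤ padicValRat p (casoratian b 7) := by
  haveI : Fact p.Prime := ⟨hpr⟩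
  have hv := cas_LB hb hb' hpr hp5 hwin hne
  by_cases hreal : ∃ x, x < p ∧ 2 ≤ classPoleCount b p x ∧ classExp b p x = -(N : ℤ)
  · have hB' := doubleDrop_of_cover hb (by norm_num) (by norm_num) hb' hpr hp5 hpb hpd hwin hcov hN hNe hchkB hreal hne
    rcases casLB_ge_of_cover hcov hLB hB1 hpd with h0 | h
    · rw [h0] at hv; exact le_trans (by exact_mod_cast hc0) hv
    · linarith
  · rcases casLB_ge_of_cover_x hcov hLBx hB1' hpd hreal with h0 | h
    · rw [h0] at hv; exact le_trans (by exact_mod_cast hc0) hv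
    · linarith

end Summit.KontsevichZagierPeriods.Zeta5Search.StairCoverKit
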